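import Mathlib
import Summits.PneNP.PneNP.Theses.OneSlice
import Summits.PneNP.PneNP.Theorems.OneSliceSliceTargetSplit
import Summits.PneNP.PneNP.Theorems.OneSliceSliceTargetSplitStability
import Summits.PneNP.PneNP.Theorems.OneSliceMonotoneContinuationDefs

/-!
# Route OneSlice, crux `MonotoneContinuation` (stmt-PneNP-18471), line `Sketch_ideator1_r1` — bridge `MC → flat-above`,
part 3: the size window of the padding (pure arithmetic)

`m` is the threshold level, `q = ⌊√m⌋`, the base slice is `j ≤ m`, the upper slice is `i ≤ j + Lq + 1`, and the sizes
`a` range over `[a₀, a₀ + q]` with `a₀ = padBase N m q j = ⌈(m + 3q - j) · N/(N - j)⌉`, so that the centre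
`i + a(1 - i/N)` of the landing level sits in `[m + 2q, m + (L+4)q + 2]`; an overlap within `q` of its mean then lands
in the good window `[m + q, m + (L+6)q]` (`bridge_window`).  The real-arithmetic steps are isolated in small lemmas.
-/

set_option linter.dupNamespace false -- `Summit.PneNP.PneNP.…`: summit = sub-problem (D-0017)

namespace Summit.PneNP.PneNP.Theorems.MonotoneContinuation

open Literature.Computability.Complexity hiding supp mem_supp
open Finset hiding slice
open Filter hiding mem_sdiff
open Classical
open Summit.PneNP.PneNP.Theorems (card_slice binomialWeight_tail_le binomialWeight_nonneg)
open Summit.PneNP.PneNP.Theorems.ConstantBand.Negative (Edge thr Central slice)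
open Summit.PneNP.PneNP.Theorems.SingleThreshold.Negative (pc tendsto_pc)
open Summit.PneNP.PneNP.Theorems.SliceACZero.Negative (supp mem_supp card_supp)
open Summit.PneNP.PneNP.Theorems.SliceTargetSplit (nbhd mem_nbhd transport ind l1 card_nbhd_of_le comp_iff_supp
  transport_ind_mem ind_nonneg ind_le_one l1_triangle l1_nonneg transport_nonneg rdist_eq_l1)

noncomputable section

variable {n : ℕ}

/-! ## Part 3a — the size window of the padding (pure arithmetic)

`m` is the threshold level, `q = ⌊√m⌋`, the base slice is `j ≤ m`, the upper slice is `i ≤ j + Lq + 1`, and the sizes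
`a` range over `[a₀, a₀ + q]` with `a₀ = ⌈(m + 3q - j) · N/(N - j)⌉`, so that the centre `i + a(1 - i/N)` of the landing
level sits in `[m + 2q, m + (L+4)q + 2]`; an overlap within `q` of its mean then lands in the good window
`[m + q, m + (L+6)q]`.  The real-arithmetic steps are isolated in small lemmas (small contexts for `nlinarith`).
-/

/-- Window arithmetic, step 1: `a₀ ≤ 3m`. -/
theorem window_a0_le {N m q j a₀ : ℝ} (hN0 : 0 < N) (hj0 : 0 ≤ j) (h2j : 2 * j ≤ N) (ha₀ : 0 ≤ a₀)
    (hupp : a₀ * (N - j) < (m + 3 * q - j) * N + (N - j)) (hm : 2 * (m + 3 * q - j) + 2 ≤ 3 * m) :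
    a₀ ≤ 3 * m := by
  have h1 : a₀ * N ≤ 2 * (a₀ * (N - j)) := by nlinarith
  have h2 : (2 * (m + 3 * q - j) + 2) * N ≤ 3 * m * N := mul_le_mul_of_nonneg_right hm hN0.le
  have h3 : a₀ * N < 3 * m * N := by nlinarith
  exact le_of_lt (lt_of_mul_lt_mul_right h3 hN0.le)

/-- Window arithmetic: `m ≤ 2 q²` for `q = ⌊√m⌋ ≥ 8`. -/
theorem window_q2 {m q : ℝ} (hq8 : 8 ≤ q) (hmq : m < (q + 1) * (q + 1)) : m ≤ 2 * q ^ 2 := by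
  nlinarith

/-- Window arithmetic: the overlap-mean correction `a (i - j) ≤ (q/2) N`. -/
theorem window_corr {N m q j L i a : ℝ} (hq0 : 0 ≤ q) (hm0 : 0 ≤ m)
    (ha4m : a ≤ 4 * m) (hji : j ≤ i) (hij : i ≤ j + L * q + 1) (h1q : 1 ≤ q) (hN : 8 * (L + 2) * m ≤ N) :
    a * i - a * j ≤ q / 2 * N := by
  have hij2 : i - j ≤ (L + 1) * q := by nlinarith
  have h1 : a * (i - j) ≤ 4 * m * ((L + 1) * q) := mul_le_mul ha4m hij2 (by linarith) (by linarith)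
  have h2 : 8 * (L + 2) * m * q ≤ N * q := mul_le_mul_of_nonneg_right hN hq0
  nlinarith

/-- Window arithmetic, step 2: the Chebyshev ratio. -/
theorem window_cheb {N m q a i : ℝ} (hN0 : 0 < N) (hq : 0 < q) (ha0 : 0 ≤ a) (hi0 : 0 ≤ i) (hm0 : 0 ≤ m)
    (ha : a ≤ 4 * m) (hi : i ≤ 2 * m) (hq2 : m ≤ 2 * q ^ 2) :
    a * i / N / q ^ 2 ≤ 20 * m / N := by
  have hqpos : (0 : ℝ) < q ^ 2 := by positivity
  have h1 : a * i ≤ 4 * m * (2 * m) := mul_le_mul ha hi hi0 (by linarith)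
  rw [div_right_comm]
  refine div_le_div_of_nonneg_right ?_ hN0.le
  rw [div_le_iff₀ hqpos]
  nlinarith

/-- Window arithmetic, step 3: the lower landing bound. -/
theorem window_lower {N m q j i a a₀ h : ℝ} (hN0 : 0 < N) (hq0 : 0 ≤ q) (hji : j ≤ i)
    (hd1 : h * N < a * i + q * N) (haD : a₀ * (N - j) ≤ a * (N - j))
    (hlow : (m + 3 * q - j) * N ≤ a₀ * (N - j)) (hcorr : a * i - a * j ≤ q / 2 * N) :
    m + q ≤ i + a - h := by
  have hiN : 0 ≤ (i - j) * N := mul_nonneg (by linarith) hN0.le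
  have hqN : 0 ≤ q * N := mul_nonneg hq0 hN0.le
  have keyN : (m + q) * N ≤ (i + a - h) * N := by nlinarith
  exact le_of_mul_le_mul_right keyN hN0

/-- Window arithmetic, step 4: the upper landing bound. -/
theorem window_upper {N m q j L i a a₀ h : ℝ} (hN0 : 0 < N) (hq2 : 2 ≤ q) (hj0 : 0 ≤ j) (ha0 : 0 ≤ a) (hq0 : 0 ≤ q)
    (hji : j ≤ i) (hij : i ≤ j + L * q + 1)
    (hd2 : a * i - q * N < h * N) (haD' : a * (N - j) ≤ (a₀ + q) * (N - j))
    (hupp : a₀ * (N - j) < (m + 3 * q - j) * N + (N - j)) :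
    i + a - h ≤ m + (L + 6) * q := by
  have hiN' : i * N ≤ (j + L * q + 1) * N := mul_le_mul_of_nonneg_right hij hN0.le
  have hqj : 0 ≤ q * j := mul_nonneg hq0 hj0
  have haj : 0 ≤ a * j := mul_nonneg ha0 hj0
  have hai : a * j ≤ a * i := mul_le_mul_of_nonneg_left hji ha0
  have hq2N : 2 * N ≤ q * N := mul_le_mul_of_nonneg_right hq2 hN0.le
  have keyN : (i + a - h) * N ≤ (m + (L + 6) * q) * N := by nlinarith
  exact le_of_mul_le_mul_right keyN hN0

/-- **The size window.** See the section header; the three conclusions are: sizes stay inside the cube, the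
Chebyshev ratio `a i/(N q²)` is `≤ 20 m/N`, and a `q`-typical overlap `h` lands in the good window. -/
theorem bridge_window {N m q j L i a h : ℕ} (hq : L + 8 ≤ q) (hqm : q * q ≤ m) (hmq : m < (q + 1) * (q + 1))
    (hjm : j ≤ m) (hji : j ≤ i) (hij : i ≤ j + L * q + 1) (hN : 8 * (L + 2) * m ≤ N)
    (ha₀ : padBase N m q j ≤ a) (ha₁ : a ≤ padBase N m q j + q) :
    a ≤ N ∧ (a : ℝ) * i / N / (q : ℝ) ^ 2 ≤ 20 * (m : ℝ) / N ∧
    (h ≤ a → |(h : ℝ) - (a : ℝ) * i / N| < q → m + q ≤ i + a - h ∧ i + a - h ≤ m + (L + 6) * q) := by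
  -- real casts of the hypotheses
  have hq8 : (8 : ℝ) ≤ q := by exact_mod_cast (show 8 ≤ q by omega)
  have hLq : (L : ℝ) ≤ q - 8 := by
    have : ((L + 8 : ℕ) : ℝ) ≤ q := by exact_mod_cast hq
    push_cast at this; linarith
  have hL0 : (0 : ℝ) ≤ L := Nat.cast_nonneg _
  have hq0 : (0 : ℝ) ≤ q := Nat.cast_nonneg _
  have hm0 : (0 : ℝ) ≤ m := Nat.cast_nonneg _
  have hj0 : (0 : ℝ) ≤ j := Nat.cast_nonneg _
  have ha0r : (0 : ℝ) ≤ a := Nat.cast_nonneg _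
  have hi0 : (0 : ℝ) ≤ i := Nat.cast_nonneg _
  have hqm' : (q : ℝ) * q ≤ m := by exact_mod_cast hqm
  have hmq' : (m : ℝ) < ((q : ℝ) + 1) * ((q : ℝ) + 1) := by exact_mod_cast hmq
  have hjm' : (j : ℝ) ≤ m := by exact_mod_cast hjm
  have hji' : (j : ℝ) ≤ i := by exact_mod_cast hji
  have hij' : (i : ℝ) ≤ j + L * q + 1 := by exact_mod_cast hij
  have hN' : 8 * ((L : ℝ) + 2) * m ≤ N := by exact_mod_cast hN
  -- products prepared for `linarith`
  have p1 : (8 : ℝ) * q ≤ q * q := mul_le_mul_of_nonneg_right hq8 hq0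
  have p2 : (L : ℝ) * q ≤ (q - 8) * q := mul_le_mul_of_nonneg_right hLq hq0
  have p3 : (16 : ℝ) * m ≤ 8 * ((L : ℝ) + 2) * m :=
    mul_le_mul_of_nonneg_right (by linarith) hm0
  have p4 : 8 * ((L : ℝ) + 1) * m ≤ 8 * ((L : ℝ) + 2) * m :=
    mul_le_mul_of_nonneg_right (by linarith) hm0
  have hm64 : (64 : ℝ) ≤ m := by linarith
  have hmq8 : 8 * (q : ℝ) ≤ m := by linarith
  have hLqm : (L : ℝ) * q + 1 ≤ m := by linarith
  have hNm : 16 * (m : ℝ) ≤ N := by linarith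
  have hN0 : (0 : ℝ) < N := by linarith
  have hD0 : (0 : ℝ) < (N : ℝ) - j := by linarith
  have hi2m : (i : ℝ) ≤ 2 * m := by linarith
  -- the real number under the ceiling
  have hsub : ((m + 3 * q - j : ℕ) : ℝ) = (m : ℝ) + 3 * q - j := by
    rw [Nat.cast_sub (by omega)]; push_cast; ring
  set x : ℝ := ((m + 3 * q - j : ℕ) : ℝ) * N / ((N : ℝ) - j) with hxdef
  have hx0 : 0 ≤ x := by rw [hxdef, hsub]; exact div_nonneg (mul_nonneg (by linarith) hN0.le) hD0.le
  have hxD : x * ((N : ℝ) - j) = ((m : ℝ) + 3 * q - j) * N := by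
    rw [hxdef, hsub, div_mul_cancel₀ _ hD0.ne']
  have ha₀x : x ≤ (padBase N m q j : ℝ) := Nat.le_ceil x
  have ha₀x1 : (padBase N m q j : ℝ) < x + 1 := Nat.ceil_lt_add_one hx0
  have ha0' : (padBase N m q j : ℝ) ≤ a := by exact_mod_cast ha₀
  have ha1' : (a : ℝ) ≤ padBase N m q j + q := by exact_mod_cast ha₁
  set a₀ : ℝ := (padBase N m q j : ℝ) with ha₀def
  have ha₀0 : 0 ≤ a₀ := le_trans hx0 ha₀x
  -- `a₀ (N - j)` is pinned between `(m+3q-j) N` and `(m+3q-j) N + (N - j)`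
  have hlow : ((m : ℝ) + 3 * q - j) * N ≤ a₀ * ((N : ℝ) - j) := by
    rw [← hxD]; exact mul_le_mul_of_nonneg_right ha₀x hD0.le
  have hupp : a₀ * ((N : ℝ) - j) < ((m : ℝ) + 3 * q - j) * N + ((N : ℝ) - j) := by
    have := mul_lt_mul_of_pos_right ha₀x1 hD0
    rw [add_mul, hxD, one_mul] at this; exact this
  have ha₀3m : a₀ ≤ 3 * m := window_a0_le hN0 hj0 (by linarith) ha₀0 hupp (by linarith)
  have ha4m : (a : ℝ) ≤ 4 * m := by linarith
  have haN : a ≤ N := by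
    have : (a : ℝ) ≤ N := by linarith
    exact_mod_cast this
  refine ⟨haN, ?_, ?_⟩
  · exact window_cheb hN0 (by linarith) ha0r hi0 hm0 ha4m hi2m (window_q2 hq8 hmq')
  · intro hha hdev
    have hcast : ((i + a - h : ℕ) : ℝ) = (i : ℝ) + a - h := by
      rw [Nat.cast_sub (by omega)]; push_cast; ring
    have hdev' := abs_lt.1 hdev
    -- clear denominators in the deviation bounds
    have hd1 : (h : ℝ) * N < (a : ℝ) * i + q * N := by
      have := mul_lt_mul_of_pos_right hdev'.2 hN0
      rw [sub_mul, div_mul_cancel₀ _ hN0.ne'] at this; linarith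
    have hd2 : (a : ℝ) * i - q * N < (h : ℝ) * N := by
      have := mul_lt_mul_of_pos_right hdev'.1 hN0
      rw [neg_mul, sub_mul, div_mul_cancel₀ _ hN0.ne'] at this; linarith
    -- the correction `a (i - j) ≤ (q/2) N`
    have hcorr : (a : ℝ) * i - (a : ℝ) * j ≤ (q : ℝ) / 2 * N :=
      window_corr hq0 hm0 ha4m hji' hij' (by linarith) hN'
    have haD : a₀ * ((N : ℝ) - j) ≤ (a : ℝ) * ((N : ℝ) - j) := mul_le_mul_of_nonneg_right ha0' hD0.le
    have haD' : (a : ℝ) * ((N : ℝ) - j) ≤ (a₀ + q) * ((N : ℝ) - j) := mul_le_mul_of_nonneg_right ha1' hD0.le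
    constructor
    · have key : (m : ℝ) + q ≤ (i : ℝ) + a - h := window_lower hN0 hq0 hji' hd1 haD hlow hcorr
      have : ((m + q : ℕ) : ℝ) ≤ ((i + a - h : ℕ) : ℝ) := by rw [hcast]; push_cast; exact key
      exact_mod_cast this
    · have key : (i : ℝ) + a - h ≤ (m : ℝ) + (L + 6) * q :=
        window_upper hN0 (by linarith) hj0 ha0r hq0 hji' hij' hd2 haD' hupp
      have : ((i + a - h : ℕ) : ℝ) ≤ ((m + (L + 6) * q : ℕ) : ℝ) := by rw [hcast]; push_cast; linarith
      exact_mod_cast this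


/-! ## Registered form -/

/-- **The size window of the bridge** (registered sub-goal `bridgeWindow` of stmt-PneNP-18471), written out. [folklore] -/
theorem bridgeWindow :
  ∀ (N m q j L i a h : ℕ), L + 8 ≤ q → q * q ≤ m → m < (q + 1) * (q + 1) → j ≤ m → j ≤ i → i ≤ j + L * q + 1 →
    8 * (L + 2) * m ≤ N → padBase N m q j ≤ a → a ≤ padBase N m q j + q →
    a ≤ N ∧ (a : ℝ) * i / N / (q : ℝ) ^ 2 ≤ 20 * (m : ℝ) / N ∧
    (h ≤ a → |(h : ℝ) - (a : ℝ) * i / N| < q → m + q ≤ i + a - h ∧ i + a - h ≤ m + (L + 6) * q) :=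
  fun _ _ _ _ _ _ _ _ hq hqm hmq hjm hji hij hN ha₀ ha₁ => bridge_window hq hqm hmq hjm hji hij hN ha₀ ha₁

end

end Summit.PneNP.PneNP.Theorems.MonotoneContinuation
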